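import Mathlib
import Summits.NavierStokesRegularity.NavierStokesRegularity.Theorems.RootDecompLitSliceSupRateClockScarLaw
import Summits.NavierStokesRegularity.NavierStokesRegularity.Theses.RootDecompLitSlice
import HarnessLib

/-!
# Route RootDecompLitSlice — leaf T₃ᴸ `NoLitInvisibleTransient` (stmt-NavierStokesRegularity-29562):
# its √-CLOCK SUB-CELL IS A THEOREM (the clock normal form T₃ᴸ ⟺ T₃ᴸᵃ, tree-side)

Helper toward T₃ᴸ (`--supports 29562`; no item, no node, no registered stub; decomp-ns census g56, tree probe
#50b, critic rows 88 (lens-6 g8 cell-local normal form) / 717 («landable as a zero-cost helper; no route split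
warranted»)).  The writer-g36 approximation principle `SupRateClockScarLaw.scar_le_two_clock_add_two_localMass`
with the two slices SWAPPED gives, for `t ∈ (T − r², T)`,
`∫_{B_r}|u(t)|² ≤ 2‖u(t) − u(T)‖₂² + 2∫_{B_r}|u(T)|² ≤ 2K√(T−t) + 2Mr ≤ (2K + 2M)·r`:

* `T3LClockCell.budget_of_scar_of_critClock` — Leray–Hopf frame + √-clock + scar bound at `x₀` ⟹ T₃ᴸ's parabolic
  budget at `x₀` (any vertex, lit or dark);
* `T3LClockCell.noLitInvisibleTransient_critClockCell` — T₃ᴸ's frame and conclusion verbatim with Uᶜ's clock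
  hypothesis inserted after tameness: the literal √-clock sub-cell of T₃ᴸ;
* `T3LClockCell.budget_of_Uc_on_critClockCell` — on the √-clock cell Uᶜ `CritTameScarIsCritical` alone delivers
  T₃ᴸ's output at every vertex (the N16 segment U → T₃ᴸ collapses to Uᶜ there; T₃ᴸ's open content lives on the
  abrupt cell).

HONEST FRAMING: bookkeeping on an UNLOADED leaf; zero load of the route moves (ROOT ⟺ U ∧ P1; loads Uᵃ ⟨31734⟩ +
P1 ⟨1217⟩); closes nothing.  Rung 0: nothing here proves NS regularity. [folklore]
-/

set_option linter.dupNamespace false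

noncomputable section

namespace Summit.NavierStokesRegularity.NavierStokesRegularity.Theorems

open MeasureTheory Set Metric Filter Topology
open scoped ENNReal
open Literature.Analysis.FluidPDE
open SupRateClockScarLaw

namespace T3LClockCell

/-- **Swapped approximation principle**: on the Leray–Hopf frame, a √-clock and a scar bound at `x₀` give T₃ᴸ's parabolic
budget at `x₀`: `r⁻¹∫_{B_r(x₀)}|u(t)|² ≤ 2·max K 0 + 2·max M 0` for `r < r₀`, `t ∈ (T − r², T)`. [folklore] -/
theorem budget_of_scar_of_critClock
    (ν T : ℝ) (_hν : 0 < ν) (hT : 0 < T)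
    (u : ℝ → EuclideanSpace ℝ (Fin 3) → EuclideanSpace ℝ (Fin 3))
    (hLH : IsLerayHopfOn T ν 0 (u 0) u)
    (hclock : ∃ K T₁ : ℝ, T₁ < T ∧ ∀ t ∈ Ioo T₁ T,
      ∫⁻ x, ‖u t x - u T x‖ₑ ^ 2 ≤ ENNReal.ofReal (K * Real.sqrt (T - t)))
    (x₀ : EuclideanSpace ℝ (Fin 3))
    (hscar : ∃ M r₁ : ℝ, 0 < r₁ ∧ ∀ r ∈ Ioo 0 r₁, r⁻¹ * ∫ x in ball x₀ r, ‖u T x‖ ^ 2 ≤ M) :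
    ∃ M r₀ : ℝ, 0 < r₀ ∧ ∀ r ∈ Ioo 0 r₀, ∀ t ∈ Ioo (T - r ^ 2) T,
      r⁻¹ * ∫ x in ball x₀ r, ‖u t x‖ ^ 2 ≤ M := by
  obtain ⟨K, T₁, hT₁, hK⟩ := hclock
  obtain ⟨M, r₁, hr₁, hM⟩ := hscar
  -- threshold: r < r₁ and r² < δ := min (T − T₁) T, so that (T − r², T) ⊂ (T₁, T) ∩ [0, T]
  set δ : ℝ := min (T - T₁) T with hδ_def
  have hδ : 0 < δ := lt_min (sub_pos.mpr hT₁) hT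
  have hδ1 : δ ≤ T - T₁ := min_le_left _ _
  have hδ2 : δ ≤ T := min_le_right _ _
  refine ⟨2 * max K 0 + 2 * max M 0, min r₁ (Real.sqrt δ), lt_min hr₁ (Real.sqrt_pos.mpr hδ),
    fun r hr t ht => ?_⟩
  have hr0 : 0 < r := hr.1
  have hrr₁ : r < r₁ := lt_of_lt_of_le hr.2 (min_le_left _ _)
  have hrδ : r < Real.sqrt δ := lt_of_lt_of_le hr.2 (min_le_right _ _)
  have hr2 : r ^ 2 < δ := by
    have hs : 0 < Real.sqrt δ - r := sub_pos.mpr hrδ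
    have hp : 0 < Real.sqrt δ + r := by positivity
    nlinarith [Real.sq_sqrt hδ.le, mul_pos hs hp]
  have htT : t < T := ht.2
  have hTt0 : 0 < T - t := sub_pos.mpr htT
  have hTt : T - t < r ^ 2 := by have := ht.1; linarith
  have ht₁ : T₁ < t := by have := ht.1; linarith
  have ht0 : 0 ≤ t := by have := ht.1; linarith
  -- memberships on the Leray–Hopf frame
  have hmT : MemLp (u T) 2 volume := hLH.memLp T ⟨hT.le, le_rfl⟩
  have hmt : MemLp (u t) 2 volume := hLH.memLp t ⟨ht0, htT.le⟩
  -- the clock term, symmetrised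
  have hH0 : 0 ≤ max K 0 * Real.sqrt (T - t) := mul_nonneg (le_max_right _ _) (Real.sqrt_nonneg _)
  have hmod : ∫⁻ x, ‖u T x - u t x‖ₑ ^ 2 ≤ ENNReal.ofReal (max K 0 * Real.sqrt (T - t)) := by
    calc ∫⁻ x, ‖u T x - u t x‖ₑ ^ 2 = ∫⁻ x, ‖u t x - u T x‖ₑ ^ 2 := by
          refine lintegral_congr fun x => ?_
          rw [← enorm_neg, neg_sub]
      _ ≤ ENNReal.ofReal (K * Real.sqrt (T - t)) := hK t ⟨ht₁, htT⟩
      _ ≤ ENNReal.ofReal (max K 0 * Real.sqrt (T - t)) :=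
          ENNReal.ofReal_le_ofReal (mul_le_mul_of_nonneg_right (le_max_left _ _) (Real.sqrt_nonneg _))
  -- the scar term
  have hB0 : 0 ≤ max M 0 * r := mul_nonneg (le_max_right _ _) hr0.le
  have hloc : ∫ x in ball x₀ r, ‖u T x‖ ^ 2 ≤ max M 0 * r := by
    have h := hM r ⟨hr0, hrr₁⟩
    rw [inv_mul_le_iff₀ hr0] at h
    calc ∫ x in ball x₀ r, ‖u T x‖ ^ 2 ≤ r * M := h
      _ ≤ r * max M 0 := mul_le_mul_of_nonneg_left (le_max_left _ _) hr0.le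
      _ = max M 0 * r := mul_comm _ _
  -- swapped approximation principle
  have hmain := scar_le_two_clock_add_two_localMass (u t) (u T) hmt hmT x₀ r hH0 hB0 hmod hloc
  -- √(T − t) ≤ r on the parabolic window
  have hsqrt : Real.sqrt (T - t) ≤ r := by
    rw [show r = Real.sqrt (r ^ 2) by rw [Real.sqrt_sq hr0.le]]
    exact Real.sqrt_le_sqrt hTt.le
  rw [inv_mul_le_iff₀ hr0]
  calc ∫ x in ball x₀ r, ‖u t x‖ ^ 2
      ≤ 2 * (max K 0 * Real.sqrt (T - t)) + 2 * (max M 0 * r) := hmain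
    _ ≤ 2 * (max K 0 * r) + 2 * (max M 0 * r) := by
        have := mul_le_mul_of_nonneg_left hsqrt (le_max_right K 0)
        linarith
    _ = r * (2 * max K 0 + 2 * max M 0) := by ring

/-- **The literal √-clock sub-cell of T₃ᴸ**: `NoLitInvisibleTransient` ⟨29562⟩'s frame and conclusion verbatim,
with Uᶜ's clock hypothesis (`CritTameScarIsCritical` ⟨31733⟩, verbatim) inserted after tameness. [folklore] -/
theorem noLitInvisibleTransient_critClockCell :
    ∀ (ν T : ℝ), 0 < ν → 0 < T → ∀ (u : ℝ → EuclideanSpace ℝ (Fin 3) → EuclideanSpace ℝ (Fin 3))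
      (p : ℝ → EuclideanSpace ℝ (Fin 3) → ℝ),
      Literature.Analysis.FluidPDE.IsMaximalSmoothSolution ν 0 u p T →
      Literature.Analysis.FluidPDE.IsLerayHopfOn T ν 0 (u 0) u →
      Literature.Analysis.FluidPDE.HasRapidSpatialDecay (u 0) →
      Filter.Tendsto (fun t => MeasureTheory.eLpNorm (u t - u T) 2 MeasureTheory.volume) (nhdsWithin T (Set.Iio T))
        (nhds 0) →
      (∃ K T₁ : ℝ, T₁ < T ∧ ∀ t ∈ Set.Ioo T₁ T,
        ∫⁻ x, ‖u t x - u T x‖ₑ ^ 2 ≤ ENNReal.ofReal (K * Real.sqrt (T - t))) →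
      ∀ x₀ : EuclideanSpace ℝ (Fin 3),
        ¬ (∃ ρ : ℝ, 0 < ρ ∧ ∀ᵐ x ∂(MeasureTheory.volume.restrict (Metric.ball x₀ ρ)), u T x = 0) →
        (∃ M r₁ : ℝ, 0 < r₁ ∧ ∀ r ∈ Set.Ioo 0 r₁, r⁻¹ * ∫ x in Metric.ball x₀ r, ‖u T x‖ ^ 2 ≤ M) →
        ∃ M r₀ : ℝ, 0 < r₀ ∧ ∀ r ∈ Set.Ioo 0 r₀, ∀ t ∈ Set.Ioo (T - r ^ 2) T,
          r⁻¹ * ∫ x in Metric.ball x₀ r, ‖u t x‖ ^ 2 ≤ M :=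
  fun ν T hν hT u _p _hmax hLH _hdec _htame hclock x₀ _hlit hscar =>
    budget_of_scar_of_critClock ν T hν hT u hLH hclock x₀ hscar

/-- **On the √-clock cell Uᶜ alone delivers T₃ᴸ's output** at every vertex (lit or dark): the N16 segment U → T₃ᴸ
collapses to Uᶜ there (with Seregin 2014 Prop. 3.11(ii) the output reads «energy-Type-I at (x₀,T)»). [folklore] -/
theorem budget_of_Uc_on_critClockCell
    (hUc : Summit.NavierStokesRegularity.NavierStokesRegularity.Theses.RootDecompLitSlice.CritTameScarIsCritical) :
    ∀ (ν T : ℝ), 0 < ν → 0 < T → ∀ (u : ℝ → EuclideanSpace ℝ (Fin 3) → EuclideanSpace ℝ (Fin 3))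
      (p : ℝ → EuclideanSpace ℝ (Fin 3) → ℝ),
      Literature.Analysis.FluidPDE.IsMaximalSmoothSolution ν 0 u p T →
      Literature.Analysis.FluidPDE.IsLerayHopfOn T ν 0 (u 0) u →
      Literature.Analysis.FluidPDE.HasRapidSpatialDecay (u 0) →
      Filter.Tendsto (fun t => MeasureTheory.eLpNorm (u t - u T) 2 MeasureTheory.volume) (nhdsWithin T (Set.Iio T))
        (nhds 0) →
      (∃ K T₁ : ℝ, T₁ < T ∧ ∀ t ∈ Set.Ioo T₁ T,
        ∫⁻ x, ‖u t x - u T x‖ₑ ^ 2 ≤ ENNReal.ofReal (K * Real.sqrt (T - t))) →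
      ∀ x₀ : EuclideanSpace ℝ (Fin 3), ∃ M r₀ : ℝ, 0 < r₀ ∧ ∀ r ∈ Set.Ioo 0 r₀, ∀ t ∈ Set.Ioo (T - r ^ 2) T,
          r⁻¹ * ∫ x in Metric.ball x₀ r, ‖u t x‖ ^ 2 ≤ M :=
  fun ν T hν hT u p hmax hLH hdec htame hclock x₀ =>
    budget_of_scar_of_critClock ν T hν hT u hLH hclock x₀ (hUc ν T hν hT u p hmax hLH hdec htame hclock x₀)

end T3LClockCell

end Summit.NavierStokesRegularity.NavierStokesRegularity.Theorems

end
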